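import Literature.NumberTheory.Automorphic.UnitaryGroupSingularBorelCoveringWeight
import Literature.NumberTheory.Automorphic.UnitaryGroupSingularBracketKAverage
import Literature.NumberTheory.Automorphic.UnitaryGroupSingularBracketIntegrable
import Literature.NumberTheory.Automorphic.UnitaryGroupSingularHeisenbergFibreBox
import Literature.NumberTheory.Automorphic.UnitaryGroupSingularTorusNormalForm
import Literature.NumberTheory.Automorphic.UnitaryGroupSingularTorusPush
import Literature.NumberTheory.Automorphic.UnitaryGroupSingularLineSchwartzBruhat
import Literature.NumberTheory.Automorphic.UnitaryGroupBorelProductWeightIntegralBochner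
import Literature.NumberTheory.Automorphic.UnitaryGroupCuspIntegralSiegelMajorant
import HarnessLib

/-!
# The value of the singular term of `U(J₃)`: `∫_G β • b_T[f] dν_G = C · V₀ · (𝔄 log(T/H₁) + 𝔅)`
(Rogawski, *Automorphic Representations of Unitary Groups in Three Variables* (1990), §7.2 Prop. 7.2.1–7.2.2,
(7.2.3)–(7.2.9), pp. 92–95: the contribution of the non-semisimple classes with semisimple part `γ₀ = d(a,b,a)` is
`𝔄 log T + 𝔅`, `𝔄, 𝔅` Tate zeta data of the Schwartz–Bruhat function `f♭ = (f^K)_{γ₀} ∘ θ` on `𝔸_F`.)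

Topic `NumberTheory/Automorphic`; namespace `Literature.NumberTheory.Automorphic.UnitaryGroup`. THEOREMS ONLY over
accepted tree modules: no definition, no named fact, no instance, no notation, no `sorry`. Row (L5-iii-c) «PROP. 7.2.2
EVALUATION at the singular class» of the T1-qs LAW 5 road (`Cruxes/H413/Lines/F0_T1InnerFormTraceIdentity.lean`),
brick (c5) «SOCKET ASSEMBLY, `G(𝔸)`-SIDE»: the chain
★ (F1) `exists_weight_iwasawa_kAverage_of_le` (Iwasawa + weight exchange, Bochner form, `Λ = B_{γ₀}(F)`, weight `w` :=
★ (c5)(9) `isCoveringWeight_singularBorelLattice_indicator_mul`, finiteness ★ (b2-β)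
`lintegral_weight_mul_enorm_singularBracket_lt_top`, invariance ★ `singularBracket_borelCentralizer_mul`)
→ ★ (c5)(10) `integral_singularBracket_mul_eq_singularBracket_kAverage` (`∫_K b_T[f](b k) = b_T[f^K](b)`)
→ ★ (G-c) `integral_indicatorProductWeight_smul_eq_of_coord` (`B(𝔸) = T(𝔸) ⋉ N(𝔸)`, ★ `sigmaFinite_and_exists_coord`, ★
`isHaarMeasure_heisHaar`)
→ ★ FILE C `torusRootModulus_inv_smul_setIntegral_box_singularBracket_mul_torus_eq` at `k = 1` (centre box, ★
`centreBox_eq_image_heisHomeomorph`)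
→ ★ (c5)(8) `singularFibre_eq_tateIntegrand` (`μ_Y := θ_* μ_A`)
→ ★ (c3)(c4) `singularTorusStage_eq_linear` (push to `𝕀_F`, two Tate integrals; `f♭ ∈ 𝒮(𝔸_F)` is ★ F0P3a-p08
`singularLine_kAverage_mem_schwartzBruhatAdele`).

* HEAD **`exists_integral_weight_smul_singularBracket_eq`**: there is `C > 0` (product of the three Haar-decomposition
  constants) such that for every `T > 0`,
  `∫_G β(g) • b_T[f](g) dν_G(g) = C · (V₀ · [½(V_F log(T/H₁)·μ_A(D_F)⁻¹ 𝔉f♭(0) + A + μ_A(D_F)⁻¹ Â − V_F f♭(0)) + ½(A_χ + μ_A(D_F)⁻¹ Â_χ)])`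
  with `V₀ = θ_*μ_A(𝓕⁻)`, `H₁ = H(1)`, `f♭(s) = ∫_{𝔸_E} ∫_K f(k⁻¹ u(x)⁻¹ γ₀ n(θ s) u(x) k)`, `A, Â, A_χ, Â_χ` the four
  half-line idelic integrals of ★ `integrableOn_and_setIntegral_tateTruncated_inter_normClasses_haar` — i.e.
  `𝔄 · log T + 𝔅` (Prop. 7.2.2), the `P_{i♭}` socket of ★ `arthurTrace_eq_sum_orbital_add_sum_central_add_sum_singular_add_sum_hyperbolic_cm`
  once composed with the `X`-side unfolding (row (b2-γ)).

## References
* J. D. Rogawski, *Automorphic Representations of Unitary Groups in Three Variables*, Ann. of Math. Stud. 123 (1990),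
  §7.2 Prop. 7.2.1, Prop. 7.2.2, (7.2.3)–(7.2.9) [Rogawski1990].
* J. Arthur, *The trace formula in invariant form*, Ann. of Math. 114 (1981), §2 [Arthur1981TraceFormulaInvariantForm].
* J. Tate, *Fourier analysis in number fields and Hecke's zeta-functions*, in Cassels–Fröhlich (1967), Ch. XV §4
  [CasselsFrohlichANT1967].
-/

set_option autoImplicit false

noncomputable section

open MeasureTheory MeasureTheory.Measure NumberField IsDedekindDomain Set Literature.MeasureTheory.Group
open scoped ENNReal NNReal MatrixGroups
open Literature.NumberTheory.Automorphic.Meyer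

namespace Literature.NumberTheory.Automorphic

namespace UnitaryGroup

variable {F E : Type} [Field F] [NumberField F] [Field E] [NumberField E] [Algebra F E]
  {c : E ≃ₐ[F] E}

variable [LocallyCompactSpace (AdeleRing (𝓞 E) E)] [LocallyCompactSpace (AdeleRing (𝓞 F) F)]
  [MeasurableSpace (AdeleRing (𝓞 E) E)] [BorelSpace (AdeleRing (𝓞 E) E)]
  [MeasurableSpace (AdeleRing (𝓞 F) F)] [BorelSpace (AdeleRing (𝓞 F) F)]
  [MeasurableSpace (quasiSplit F E c 3).Adelic] [BorelSpace (quasiSplit F E c 3).Adelic]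
  [MeasurableSpace (GaloisRepresentations.ideleGroup F)] [BorelSpace (GaloisRepresentations.ideleGroup F)]
  [Algebra.IsQuadraticExtension F E]

set_option maxHeartbeats 800000 in
/-- **THE VALUE OF THE SINGULAR TERM (Prop. 7.2.2).** For the singular base point `γ₀ = ι(d(a,b,a))` (`a ≠ b`) of
`U(J₃)`, a test function `f`, the adelic Iwasawa decomposition `hBK`, Haar measures `ν_G, μ_B, μ_T, μ_K, μ_X, μ_A, ν_F`,
an idele class domain `𝓕F`, a covering weight `β` of `B_{γ₀}(F)♯` on `G(𝔸_F)` and a covering weight `w_T` of `T(F)_T` on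
`T(𝔸_F)`: there is `C > 0` with, for every `T > 0`,
`∫_G β(g) • b_T[f](g) dν_G = C · (V₀ · ((c4)-bracket of f♭ at log(T/H(1))))` — the singular term is `𝔄 log T + 𝔅`.
The centre measure is `μ_Y := θ_* μ_A` (`θ = traceZeroLine`), `f♭(s) = ∫_{𝔸_E} f^K(u(x)⁻¹ γ₀ n(θ s) u(x)) dμ_X`,
`f^K(z) = ∫_K f(k⁻¹ z k) dμ_K`. [cite: Rogawski1990, §7.2 Prop. 7.2.1, Prop. 7.2.2, (7.2.3)–(7.2.9) (pp. 92–95)]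
[cite: CasselsFrohlichANT1967, Ch. XV Thm. 4.3.2] -/
theorem exists_integral_weight_smul_singularBracket_eq (hc : c * c = 1) (hc1 : c ≠ 1)
    {a b : Eˣ} (hab : (a : E) ≠ (b : E)) {g₀ : (quasiSplit F E c 3).Rational} {γ₀ : (quasiSplit F E c 3).arithmeticSubgroup}
    (hg₀ : ((g₀.val : GL (Fin 3) E) : Matrix (Fin 3) (Fin 3) E) = !![(a : E), 0, 0; 0, b, 0; 0, 0, a])
    (hγ₀ : (γ₀ : (quasiSplit F E c 3).Adelic) = (quasiSplit F E c 3).toAdelic g₀)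
    {δ : E} (hcδ : c δ = -δ) (hδ : δ ≠ 0) (θ₀ : 𝓞 F) (hθ : θ₀ ≠ 0) (hd : δ * δ = algebraMap F E (θ₀ : F))
    (hsq : ¬ IsSquare ((θ₀ : 𝓞 F) : F))
    {f : (quasiSplit F E c 3).Adelic → ℂ} (hf : IsQuasiSplitTest F E c 3 f)
    (hBK : ∀ g : (quasiSplit F E c 3).Adelic, ∃ b ∈ borelAdelic F E c 3, ∃ k : (quasiSplit F E c 3).Adelic,
      adelicVal F E c 3 ((StdForm.antidiagonal 3).over E) k ∈ standardMaximalCompactGL 3 E ∧ g = b * k)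
    (νG : Measure (quasiSplit F E c 3).Adelic) [νG.IsHaarMeasure]
    (μB : Measure (borelAdelic F E c 3)) [μB.IsHaarMeasure]
    (μT : Measure (torusInBorel F E c 3)) [μT.IsHaarMeasure]
    (μK : Measure ↥((standardMaximalCompactGL 3 E).comap (adelicVal F E c 3 ((StdForm.antidiagonal 3).over E)) : Subgroup (quasiSplit F E c 3).Adelic)) [μK.IsHaarMeasure]
    (μX : Measure (AdeleRing (𝓞 E) E)) [μX.IsAddHaarMeasure] [μX.Regular]
    (μA : Measure (AdeleRing (𝓞 F) F)) [μA.IsAddHaarMeasure] [μA.Regular]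
    (νF : Measure (GaloisRepresentations.ideleGroup F)) [νF.IsHaarMeasure]
    {𝓕F : Set (GaloisRepresentations.ideleGroup F)} (h𝓕 : IsIdeleClassDomain F 𝓕F)
    {β : (quasiSplit F E c 3).Adelic → ℝ≥0∞}
    (hβ : IsCoveringWeight ((arithmeticBorel F E c 3 ⊓
      Subgroup.centralizer ({γ₀} : Set (quasiSplit F E c 3).arithmeticSubgroup)).map (quasiSplit F E c 3).arithmeticSubgroup.subtype) β)
    {wT : torusInBorel F E c 3 → ℝ≥0∞}
    (hwT : IsCoveringWeight ((rationalBorel F E c 3).subgroupOf (torusInBorel F E c 3)) wT) :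
    ∃ C : ℝ, 0 < C ∧ ∀ T : ℝ≥0, 0 < (T : ℝ) →
      ∫ g, (β g).toReal • ((∑' n : {n : ↥((adelicUnipotent F E c 3).subgroupOf (quasiSplit F E c 3).arithmeticSubgroup ⊓
            Subgroup.centralizer ({γ₀} : Set (quasiSplit F E c 3).arithmeticSubgroup)) // n ≠ 1},
          f ((g)⁻¹ * (((n.1 : (quasiSplit F E c 3).arithmeticSubgroup) * γ₀ : (quasiSplit F E c 3).arithmeticSubgroup) : (quasiSplit F E c 3).Adelic) * (g))) -
        Set.indicator {z : (quasiSplit F E c 3).Adelic | T < borelHeight z}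
          (fun z => ((μA.map (traceZeroLine F E c hcδ hδ)) (traceZeroFundamentalDomain F E c)).toReal⁻¹ • ∫ w : traceZeroAdele F E c,
            f (z⁻¹ * ((γ₀ : (quasiSplit F E c 3).Adelic) * (((heisElt hc 0 w : unipotentInBorel F E c 3) : borelAdelic F E c 3) : (quasiSplit F E c 3).Adelic)) * z) ∂(μA.map (traceZeroLine F E c hcδ hδ))) (g)) ∂νG =
        (C : ℂ) * ((((μA.map (traceZeroLine F E c hcδ hδ)).real (traceZeroFundamentalDomain F E c) : ℝ) : ℂ) *
          ((1 / 2 : ℂ) * ((((idelicCovolume F νF).toReal * Real.log ((T : ℝ) / ((borelHeight (1 : (quasiSplit F E c 3).Adelic) : ℝ≥0) : ℝ)) : ℝ) : ℂ) *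
                (((μA (adeleFundamentalDomain F)).toReal⁻¹ : ℂ) * adeleFourier F μA (fun s : AdeleRing (𝓞 F) F =>
      ∫ x : AdeleRing (𝓞 E) E, (∫ k : ↥((standardMaximalCompactGL 3 E).comap (adelicVal F E c 3 ((StdForm.antidiagonal 3).over E)) : Subgroup (quasiSplit F E c 3).Adelic), f ((k : (quasiSplit F E c 3).Adelic)⁻¹ *
        (((((heisElt hc x (0 : traceZeroAdele F E c) : unipotentInBorel F E c 3) : borelAdelic F E c 3) : (quasiSplit F E c 3).Adelic))⁻¹ *
          ((γ₀ : (quasiSplit F E c 3).Adelic) * (((heisElt hc 0 (traceZeroLine F E c hcδ hδ s) : unipotentInBorel F E c 3) : borelAdelic F E c 3) : (quasiSplit F E c 3).Adelic)) *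
          (((heisElt hc x (0 : traceZeroAdele F E c) : unipotentInBorel F E c 3) : borelAdelic F E c 3) : (quasiSplit F E c 3).Adelic)) * (k : (quasiSplit F E c 3).Adelic)) ∂μK) ∂μX) 0) +
              ((∫ x in {x | 1 ≤ (IdeleClassGroup.ideleNorm F x : ℝ)} ∩ 𝓕F,
                  ideleSum F (fun s : AdeleRing (𝓞 F) F =>
      ∫ x : AdeleRing (𝓞 E) E, (∫ k : ↥((standardMaximalCompactGL 3 E).comap (adelicVal F E c 3 ((StdForm.antidiagonal 3).over E)) : Subgroup (quasiSplit F E c 3).Adelic), f ((k : (quasiSplit F E c 3).Adelic)⁻¹ *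
        (((((heisElt hc x (0 : traceZeroAdele F E c) : unipotentInBorel F E c 3) : borelAdelic F E c 3) : (quasiSplit F E c 3).Adelic))⁻¹ *
          ((γ₀ : (quasiSplit F E c 3).Adelic) * (((heisElt hc 0 (traceZeroLine F E c hcδ hδ s) : unipotentInBorel F E c 3) : borelAdelic F E c 3) : (quasiSplit F E c 3).Adelic)) *
          (((heisElt hc x (0 : traceZeroAdele F E c) : unipotentInBorel F E c 3) : borelAdelic F E c 3) : (quasiSplit F E c 3).Adelic)) * (k : (quasiSplit F E c 3).Adelic)) ∂μK) ∂μX) x * ((IdeleClassGroup.ideleNorm F x : ℝ) : ℂ) ∂νF) +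
                ((μA (adeleFundamentalDomain F)).toReal⁻¹ : ℂ) *
                  (∫ x in {x | 1 ≤ (IdeleClassGroup.ideleNorm F x : ℝ)} ∩ 𝓕F,
                    ideleSum F (adeleFourier F μA (fun s : AdeleRing (𝓞 F) F =>
      ∫ x : AdeleRing (𝓞 E) E, (∫ k : ↥((standardMaximalCompactGL 3 E).comap (adelicVal F E c 3 ((StdForm.antidiagonal 3).over E)) : Subgroup (quasiSplit F E c 3).Adelic), f ((k : (quasiSplit F E c 3).Adelic)⁻¹ *
        (((((heisElt hc x (0 : traceZeroAdele F E c) : unipotentInBorel F E c 3) : borelAdelic F E c 3) : (quasiSplit F E c 3).Adelic))⁻¹ *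
          ((γ₀ : (quasiSplit F E c 3).Adelic) * (((heisElt hc 0 (traceZeroLine F E c hcδ hδ s) : unipotentInBorel F E c 3) : borelAdelic F E c 3) : (quasiSplit F E c 3).Adelic)) *
          (((heisElt hc x (0 : traceZeroAdele F E c) : unipotentInBorel F E c 3) : borelAdelic F E c 3) : (quasiSplit F E c 3).Adelic)) * (k : (quasiSplit F E c 3).Adelic)) ∂μK) ∂μX)) x ∂νF) -
                ((idelicCovolume F νF).toReal : ℂ) * (fun s : AdeleRing (𝓞 F) F =>
      ∫ x : AdeleRing (𝓞 E) E, (∫ k : ↥((standardMaximalCompactGL 3 E).comap (adelicVal F E c 3 ((StdForm.antidiagonal 3).over E)) : Subgroup (quasiSplit F E c 3).Adelic), f ((k : (quasiSplit F E c 3).Adelic)⁻¹ *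
        (((((heisElt hc x (0 : traceZeroAdele F E c) : unipotentInBorel F E c 3) : borelAdelic F E c 3) : (quasiSplit F E c 3).Adelic))⁻¹ *
          ((γ₀ : (quasiSplit F E c 3).Adelic) * (((heisElt hc 0 (traceZeroLine F E c hcδ hδ s) : unipotentInBorel F E c 3) : borelAdelic F E c 3) : (quasiSplit F E c 3).Adelic)) *
          (((heisElt hc x (0 : traceZeroAdele F E c) : unipotentInBorel F E c 3) : borelAdelic F E c 3) : (quasiSplit F E c 3).Adelic)) * (k : (quasiSplit F E c 3).Adelic)) ∂μK) ∂μX) 0)) +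
            (1 / 2 : ℂ) * ((∫ x in {x | 1 ≤ (IdeleClassGroup.ideleNorm F x : ℝ)} ∩ 𝓕F,
                ideleSum F (fun s : AdeleRing (𝓞 F) F =>
      ∫ x : AdeleRing (𝓞 E) E, (∫ k : ↥((standardMaximalCompactGL 3 E).comap (adelicVal F E c 3 ((StdForm.antidiagonal 3).over E)) : Subgroup (quasiSplit F E c 3).Adelic), f ((k : (quasiSplit F E c 3).Adelic)⁻¹ *
        (((((heisElt hc x (0 : traceZeroAdele F E c) : unipotentInBorel F E c 3) : borelAdelic F E c 3) : (quasiSplit F E c 3).Adelic))⁻¹ *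
          ((γ₀ : (quasiSplit F E c 3).Adelic) * (((heisElt hc 0 (traceZeroLine F E c hcδ hδ s) : unipotentInBorel F E c 3) : borelAdelic F E c 3) : (quasiSplit F E c 3).Adelic)) *
          (((heisElt hc x (0 : traceZeroAdele F E c) : unipotentInBorel F E c 3) : borelAdelic F E c 3) : (quasiSplit F E c 3).Adelic)) * (k : (quasiSplit F E c 3).Adelic)) ∂μK) ∂μX) x * (-1 : ℂ) ^ (GaloisRepresentations.quadraticArtinIndicator F ((θ₀ : 𝓞 F) : F) x).val *
                  ((IdeleClassGroup.ideleNorm F x : ℝ) : ℂ) ∂νF) +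
              ((μA (adeleFundamentalDomain F)).toReal⁻¹ : ℂ) *
                ∫ x in {x | 1 ≤ (IdeleClassGroup.ideleNorm F x : ℝ)} ∩ 𝓕F,
                  ideleSum F (adeleFourier F μA (fun s : AdeleRing (𝓞 F) F =>
      ∫ x : AdeleRing (𝓞 E) E, (∫ k : ↥((standardMaximalCompactGL 3 E).comap (adelicVal F E c 3 ((StdForm.antidiagonal 3).over E)) : Subgroup (quasiSplit F E c 3).Adelic), f ((k : (quasiSplit F E c 3).Adelic)⁻¹ *
        (((((heisElt hc x (0 : traceZeroAdele F E c) : unipotentInBorel F E c 3) : borelAdelic F E c 3) : (quasiSplit F E c 3).Adelic))⁻¹ *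
          ((γ₀ : (quasiSplit F E c 3).Adelic) * (((heisElt hc 0 (traceZeroLine F E c hcδ hδ s) : unipotentInBorel F E c 3) : borelAdelic F E c 3) : (quasiSplit F E c 3).Adelic)) *
          (((heisElt hc x (0 : traceZeroAdele F E c) : unipotentInBorel F E c 3) : borelAdelic F E c 3) : (quasiSplit F E c 3).Adelic)) * (k : (quasiSplit F E c 3).Adelic)) ∂μK) ∂μX)) x *
                    (-1 : ℂ) ^ (GaloisRepresentations.quadraticArtinIndicator F ((θ₀ : 𝓞 F) : F) x⁻¹).val ∂νF))) := by
  classical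
  -- ### structure
  haveI : T2Space (quasiSplit F E c 3).Adelic := inferInstanceAs (T2Space (adelic F E c 3 ((StdForm.antidiagonal 3).over E)))
  haveI : SecondCountableTopology (quasiSplit F E c 3).Adelic :=
    inferInstanceAs (SecondCountableTopology (adelic F E c 3 ((StdForm.antidiagonal 3).over E)))
  haveI := t2Space_adeleRing_of_numberField E
  haveI := secondCountableTopology_adeleRing E
  haveI := secondCountableTopology_adeleRing F
  haveI := locallyCompactSpace_traceZeroAdele (F := F) (E := E) (c := c)
  haveI : SecondCountableTopology (traceZeroAdele F E c) := TopologicalSpace.Subtype.secondCountableTopology _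
  haveI : BorelSpace (traceZeroAdele F E c) := Subtype.borelSpace _
  haveI : BorelSpace (borelAdelic F E c 3) := Subtype.borelSpace _
  haveI : BorelSpace (unipotentInBorel F E c 3) := Subtype.borelSpace _
  haveI : BorelSpace (torusInBorel F E c 3) := Subtype.borelSpace _
  -- the centre measure `μ_Y := θ_* μ_A`
  haveI hμY : (μA.map (traceZeroLine F E c hcδ hδ)).IsAddHaarMeasure := (traceZeroLine F E c hcδ hδ).isAddHaarMeasure_map μA
  haveI : (μA.map (traceZeroLine F E c hcδ hδ)).Regular := Regular.map (traceZeroLine F E c hcδ hδ).toHomeomorph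
  -- `K_U`
  have hKc : IsCompact (((standardMaximalCompactGL 3 E).comap (adelicVal F E c 3 ((StdForm.antidiagonal 3).over E)) : Subgroup (quasiSplit F E c 3).Adelic) : Set (quasiSplit F E c 3).Adelic) := isCompact_comap_adelicVal_standardMaximalCompactGL
  haveI : CompactSpace ↥((standardMaximalCompactGL 3 E).comap (adelicVal F E c 3 ((StdForm.antidiagonal 3).over E)) : Subgroup (quasiSplit F E c 3).Adelic) := isCompact_iff_compactSpace.1 hKc
  haveI : IsFiniteMeasure μK := CompactSpace.isFiniteMeasure
  have hH : ∀ (z : (quasiSplit F E c 3).Adelic) (k : ↥((standardMaximalCompactGL 3 E).comap (adelicVal F E c 3 ((StdForm.antidiagonal 3).over E)) : Subgroup (quasiSplit F E c 3).Adelic)), borelHeight (z * (k : (quasiSplit F E c 3).Adelic)) = borelHeight z := fun z k =>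
    borelHeight_mul_of_mem_comap_standardMaximalCompactGL k.2 z
  -- `f^K` is a test function
  have hfKc : Continuous fun z : (quasiSplit F E c 3).Adelic => (∫ k : ↥((standardMaximalCompactGL 3 E).comap (adelicVal F E c 3 ((StdForm.antidiagonal 3).over E)) : Subgroup (quasiSplit F E c 3).Adelic), f ((k : (quasiSplit F E c 3).Adelic)⁻¹ * (z) * (k : (quasiSplit F E c 3).Adelic)) ∂μK) := continuous_kConjAverage hKc μK hf.continuous'
  have hfKs : HasCompactSupport fun z : (quasiSplit F E c 3).Adelic => (∫ k : ↥((standardMaximalCompactGL 3 E).comap (adelicVal F E c 3 ((StdForm.antidiagonal 3).over E)) : Subgroup (quasiSplit F E c 3).Adelic), f ((k : (quasiSplit F E c 3).Adelic)⁻¹ * (z) * (k : (quasiSplit F E c 3).Adelic)) ∂μK) := hasCompactSupport_kConjAverage hKc μK hf.hasCompactSupport'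
  -- `f♭ ∈ 𝒮(𝔸_F)` (★ F0P3a-p08)
  have hfS : (fun s : AdeleRing (𝓞 F) F =>
      ∫ x : AdeleRing (𝓞 E) E, (∫ k : ↥((standardMaximalCompactGL 3 E).comap (adelicVal F E c 3 ((StdForm.antidiagonal 3).over E)) : Subgroup (quasiSplit F E c 3).Adelic), f ((k : (quasiSplit F E c 3).Adelic)⁻¹ *
        (((((heisElt hc x (0 : traceZeroAdele F E c) : unipotentInBorel F E c 3) : borelAdelic F E c 3) : (quasiSplit F E c 3).Adelic))⁻¹ *
          ((γ₀ : (quasiSplit F E c 3).Adelic) * (((heisElt hc 0 (traceZeroLine F E c hcδ hδ s) : unipotentInBorel F E c 3) : borelAdelic F E c 3) : (quasiSplit F E c 3).Adelic)) *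
          (((heisElt hc x (0 : traceZeroAdele F E c) : unipotentInBorel F E c 3) : borelAdelic F E c 3) : (quasiSplit F E c 3).Adelic)) * (k : (quasiSplit F E c 3).Adelic)) ∂μK) ∂μX) ∈ schwartzBruhatAdele F :=
    singularLine_kAverage_mem_schwartzBruhatAdele hc hcδ hδ hab hg₀ hγ₀ μX hKc μK hf
  -- quadratic
  have h2 : Module.finrank F E = 2 := Algebra.IsQuadraticExtension.finrank_eq_two F E
  -- ### (F1): Iwasawa + weight exchange for `Λ = B_{γ₀}(F)`
  obtain ⟨C₁, hC₁, -, -, hBoch⟩ := exists_weight_iwasawa_kAverage_of_le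
    (arithmeticBorel F E c 3 ⊓ Subgroup.centralizer ({γ₀} : Set (quasiSplit F E c 3).arithmeticSubgroup)) inf_le_left νG μB μK hBK
  have hw := isCoveringWeight_singularBorelLattice_indicator_mul hc hab hg₀ hγ₀ hwT
  -- ### (G-c): the coordinates `B(𝔸) = T(𝔸) ⋉ N(𝔸)` with `μ_N := heisHaar`
  haveI hμN : (heisHaar hc μX (μA.map (traceZeroLine F E c hcδ hδ))).IsHaarMeasure := isHaarMeasure_heisHaar hc μX (μA.map (traceZeroLine F E c hcδ hδ))
  obtain ⟨hσT, hσN, C₂, hC₂0, hC₂t, hform⟩ := sigmaFinite_and_exists_coord μB μT (heisHaar hc μX (μA.map (traceZeroLine F E c hcδ hδ)))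
  haveI := hσT
  haveI := hσN
  -- ### (c3)(c4): the torus stage in normal form
  have hH₁ : 0 < ((borelHeight (1 : (quasiSplit F E c 3).Adelic) : ℝ≥0) : ℝ) := by exact_mod_cast borelHeight_pos (1 : (quasiSplit F E c 3).Adelic)
  set R : ℝ≥0 → torusInBorel F E c 3 → ℂ := fun T t => ((ideleSum F (fun s : AdeleRing (𝓞 F) F =>
      ∫ x : AdeleRing (𝓞 E) E, (∫ k : ↥((standardMaximalCompactGL 3 E).comap (adelicVal F E c 3 ((StdForm.antidiagonal 3).over E)) : Subgroup (quasiSplit F E c 3).Adelic), f ((k : (quasiSplit F E c 3).Adelic)⁻¹ *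
        (((((heisElt hc x (0 : traceZeroAdele F E c) : unipotentInBorel F E c 3) : borelAdelic F E c 3) : (quasiSplit F E c 3).Adelic))⁻¹ *
          ((γ₀ : (quasiSplit F E c 3).Adelic) * (((heisElt hc 0 (traceZeroLine F E c hcδ hδ s) : unipotentInBorel F E c 3) : borelAdelic F E c 3) : (quasiSplit F E c 3).Adelic)) *
          (((heisElt hc x (0 : traceZeroAdele F E c) : unipotentInBorel F E c 3) : borelAdelic F E c 3) : (quasiSplit F E c 3).Adelic)) * (k : (quasiSplit F E c 3).Adelic)) ∂μK) ∂μX) (AdeleRing.ideleRelNorm F E (diagUnit (t : borelAdelic F E c 3).2 0))⁻¹ -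
              ((IdeleClassGroup.ideleNorm F (AdeleRing.ideleRelNorm F E (diagUnit (t : borelAdelic F E c 3).2 0))⁻¹ : ℝ) : ℂ)⁻¹ *
                {y : GaloisRepresentations.ideleGroup F |
                    (IdeleClassGroup.ideleNorm F y : ℝ) < ((T : ℝ) / ((borelHeight (1 : (quasiSplit F E c 3).Adelic) : ℝ≥0) : ℝ))⁻¹}.indicator
                  (fun _ => ((μA (adeleFundamentalDomain F)).toReal⁻¹ : ℂ) * adeleFourier F μA (fun s : AdeleRing (𝓞 F) F =>
      ∫ x : AdeleRing (𝓞 E) E, (∫ k : ↥((standardMaximalCompactGL 3 E).comap (adelicVal F E c 3 ((StdForm.antidiagonal 3).over E)) : Subgroup (quasiSplit F E c 3).Adelic), f ((k : (quasiSplit F E c 3).Adelic)⁻¹ *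
        (((((heisElt hc x (0 : traceZeroAdele F E c) : unipotentInBorel F E c 3) : borelAdelic F E c 3) : (quasiSplit F E c 3).Adelic))⁻¹ *
          ((γ₀ : (quasiSplit F E c 3).Adelic) * (((heisElt hc 0 (traceZeroLine F E c hcδ hδ s) : unipotentInBorel F E c 3) : borelAdelic F E c 3) : (quasiSplit F E c 3).Adelic)) *
          (((heisElt hc x (0 : traceZeroAdele F E c) : unipotentInBorel F E c 3) : borelAdelic F E c 3) : (quasiSplit F E c 3).Adelic)) * (k : (quasiSplit F E c 3).Adelic)) ∂μK) ∂μX) 0)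
                  (AdeleRing.ideleRelNorm F E (diagUnit (t : borelAdelic F E c 3).2 0))⁻¹) *
            ((IdeleClassGroup.ideleNorm F (AdeleRing.ideleRelNorm F E (diagUnit (t : borelAdelic F E c 3).2 0))⁻¹ : ℝ) : ℂ)) with hR
  set Θ : ℝ≥0 → torusInBorel F E c 3 → ℂ := fun T t =>
    (((torusRootModulus E 3 (diagUnit (t : borelAdelic F E c 3).2) : ℝ≥0) : ℝ)) • ((((μA.map (traceZeroLine F E c hcδ hδ)).real (traceZeroFundamentalDomain F E c) : ℝ) : ℂ) * R T t) with hΘ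
  have hΘnf : ∀ (T : ℝ≥0) (t : torusInBorel F E c 3),
      ((torusRootModulus E 3 (diagUnit (t : borelAdelic F E c 3).2) : ℝ≥0) : ℝ)⁻¹ • Θ T t =
        (((μA.map (traceZeroLine F E c hcδ hδ)).real (traceZeroFundamentalDomain F E c) : ℝ) : ℂ) * ((ideleSum F (fun s : AdeleRing (𝓞 F) F =>
      ∫ x : AdeleRing (𝓞 E) E, (∫ k : ↥((standardMaximalCompactGL 3 E).comap (adelicVal F E c 3 ((StdForm.antidiagonal 3).over E)) : Subgroup (quasiSplit F E c 3).Adelic), f ((k : (quasiSplit F E c 3).Adelic)⁻¹ *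
        (((((heisElt hc x (0 : traceZeroAdele F E c) : unipotentInBorel F E c 3) : borelAdelic F E c 3) : (quasiSplit F E c 3).Adelic))⁻¹ *
          ((γ₀ : (quasiSplit F E c 3).Adelic) * (((heisElt hc 0 (traceZeroLine F E c hcδ hδ s) : unipotentInBorel F E c 3) : borelAdelic F E c 3) : (quasiSplit F E c 3).Adelic)) *
          (((heisElt hc x (0 : traceZeroAdele F E c) : unipotentInBorel F E c 3) : borelAdelic F E c 3) : (quasiSplit F E c 3).Adelic)) * (k : (quasiSplit F E c 3).Adelic)) ∂μK) ∂μX) (AdeleRing.ideleRelNorm F E (diagUnit (t : borelAdelic F E c 3).2 0))⁻¹ -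
              ((IdeleClassGroup.ideleNorm F (AdeleRing.ideleRelNorm F E (diagUnit (t : borelAdelic F E c 3).2 0))⁻¹ : ℝ) : ℂ)⁻¹ *
                {y : GaloisRepresentations.ideleGroup F |
                    (IdeleClassGroup.ideleNorm F y : ℝ) < ((T : ℝ) / ((borelHeight (1 : (quasiSplit F E c 3).Adelic) : ℝ≥0) : ℝ))⁻¹}.indicator
                  (fun _ => ((μA (adeleFundamentalDomain F)).toReal⁻¹ : ℂ) * adeleFourier F μA (fun s : AdeleRing (𝓞 F) F =>
      ∫ x : AdeleRing (𝓞 E) E, (∫ k : ↥((standardMaximalCompactGL 3 E).comap (adelicVal F E c 3 ((StdForm.antidiagonal 3).over E)) : Subgroup (quasiSplit F E c 3).Adelic), f ((k : (quasiSplit F E c 3).Adelic)⁻¹ *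
        (((((heisElt hc x (0 : traceZeroAdele F E c) : unipotentInBorel F E c 3) : borelAdelic F E c 3) : (quasiSplit F E c 3).Adelic))⁻¹ *
          ((γ₀ : (quasiSplit F E c 3).Adelic) * (((heisElt hc 0 (traceZeroLine F E c hcδ hδ s) : unipotentInBorel F E c 3) : borelAdelic F E c 3) : (quasiSplit F E c 3).Adelic)) *
          (((heisElt hc x (0 : traceZeroAdele F E c) : unipotentInBorel F E c 3) : borelAdelic F E c 3) : (quasiSplit F E c 3).Adelic)) * (k : (quasiSplit F E c 3).Adelic)) ∂μK) ∂μX) 0)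
                  (AdeleRing.ideleRelNorm F E (diagUnit (t : borelAdelic F E c 3).2 0))⁻¹) *
            ((IdeleClassGroup.ideleNorm F (AdeleRing.ideleRelNorm F E (diagUnit (t : borelAdelic F E c 3).2 0))⁻¹ : ℝ) : ℂ)) := fun T t => by
    simp only [hΘ, hR]
    rw [inv_smul_smul₀ (by exact_mod_cast (torusRootModulus_pos E 3 _).ne')]
  obtain ⟨C₃, hC₃0, hC₃t, hlin⟩ := singularTorusStage_eq_linear hc hc1 hcδ hδ θ₀ hθ hd hsq μT μA νF h𝓕 hwT hfS hH₁
    ((μA.map (traceZeroLine F E c hcδ hδ)).real (traceZeroFundamentalDomain F E c)) hΘnf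
  have hC₂pos : 0 < C₂.toReal := ENNReal.toReal_pos hC₂0 hC₂t
  have hC₃pos : 0 < C₃.toReal := ENNReal.toReal_pos hC₃0 hC₃t
  refine ⟨(C₁ : ℝ) * C₂.toReal * C₃.toReal, by positivity, fun T hT => ?_⟩
  have hT' : 0 < T := by exact_mod_cast hT
  -- ### Step A — (F1) (BΛ) applied to `ψ := b_T[f]`
  have hψm : Measurable fun g : (quasiSplit F E c 3).Adelic => ((∑' n : {n : ↥((adelicUnipotent F E c 3).subgroupOf (quasiSplit F E c 3).arithmeticSubgroup ⊓
            Subgroup.centralizer ({γ₀} : Set (quasiSplit F E c 3).arithmeticSubgroup)) // n ≠ 1},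
          f ((g)⁻¹ * (((n.1 : (quasiSplit F E c 3).arithmeticSubgroup) * γ₀ : (quasiSplit F E c 3).arithmeticSubgroup) : (quasiSplit F E c 3).Adelic) * (g))) -
        Set.indicator {z : (quasiSplit F E c 3).Adelic | T < borelHeight z}
          (fun z => ((μA.map (traceZeroLine F E c hcδ hδ)) (traceZeroFundamentalDomain F E c)).toReal⁻¹ • ∫ w : traceZeroAdele F E c,
            f (z⁻¹ * ((γ₀ : (quasiSplit F E c 3).Adelic) * (((heisElt hc 0 w : unipotentInBorel F E c 3) : borelAdelic F E c 3) : (quasiSplit F E c 3).Adelic)) * z) ∂(μA.map (traceZeroLine F E c hcδ hδ))) (g)) := measurable_singularBracket hc γ₀ (μA.map (traceZeroLine F E c hcδ hδ)) T hf.continuous'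
  have hψinv : ∀ b ∈ arithmeticBorel F E c 3 ⊓ Subgroup.centralizer ({γ₀} : Set (quasiSplit F E c 3).arithmeticSubgroup), ∀ y : (quasiSplit F E c 3).Adelic,
      (fun g : (quasiSplit F E c 3).Adelic => ((∑' n : {n : ↥((adelicUnipotent F E c 3).subgroupOf (quasiSplit F E c 3).arithmeticSubgroup ⊓
            Subgroup.centralizer ({γ₀} : Set (quasiSplit F E c 3).arithmeticSubgroup)) // n ≠ 1},
          f ((g)⁻¹ * (((n.1 : (quasiSplit F E c 3).arithmeticSubgroup) * γ₀ : (quasiSplit F E c 3).arithmeticSubgroup) : (quasiSplit F E c 3).Adelic) * (g))) -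
        Set.indicator {z : (quasiSplit F E c 3).Adelic | T < borelHeight z}
          (fun z => ((μA.map (traceZeroLine F E c hcδ hδ)) (traceZeroFundamentalDomain F E c)).toReal⁻¹ • ∫ w : traceZeroAdele F E c,
            f (z⁻¹ * ((γ₀ : (quasiSplit F E c 3).Adelic) * (((heisElt hc 0 w : unipotentInBorel F E c 3) : borelAdelic F E c 3) : (quasiSplit F E c 3).Adelic)) * z) ∂(μA.map (traceZeroLine F E c hcδ hδ))) (g))) ((b : (quasiSplit F E c 3).Adelic) * y) = (fun g : (quasiSplit F E c 3).Adelic => ((∑' n : {n : ↥((adelicUnipotent F E c 3).subgroupOf (quasiSplit F E c 3).arithmeticSubgroup ⊓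
            Subgroup.centralizer ({γ₀} : Set (quasiSplit F E c 3).arithmeticSubgroup)) // n ≠ 1},
          f ((g)⁻¹ * (((n.1 : (quasiSplit F E c 3).arithmeticSubgroup) * γ₀ : (quasiSplit F E c 3).arithmeticSubgroup) : (quasiSplit F E c 3).Adelic) * (g))) -
        Set.indicator {z : (quasiSplit F E c 3).Adelic | T < borelHeight z}
          (fun z => ((μA.map (traceZeroLine F E c hcδ hδ)) (traceZeroFundamentalDomain F E c)).toReal⁻¹ • ∫ w : traceZeroAdele F E c,
            f (z⁻¹ * ((γ₀ : (quasiSplit F E c 3).Adelic) * (((heisElt hc 0 w : unipotentInBorel F E c 3) : borelAdelic F E c 3) : (quasiSplit F E c 3).Adelic)) * z) ∂(μA.map (traceZeroLine F E c hcδ hδ))) (g))) y := fun b hb y =>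
    singularBracket_borelCentralizer_mul hc hc1 γ₀ (μA.map (traceZeroLine F E c hcδ hδ)) T f hb y
  have hfin := lintegral_weight_mul_enorm_singularBracket_lt_top hc hc1 h2 hab hg₀ hγ₀ hf hBK νG μB μT μK μX (μA.map (traceZeroLine F E c hcδ hδ)) hβ hT'
  obtain ⟨hintB, hA⟩ := hBoch β hβ _ hw (fun g : (quasiSplit F E c 3).Adelic => ((∑' n : {n : ↥((adelicUnipotent F E c 3).subgroupOf (quasiSplit F E c 3).arithmeticSubgroup ⊓
            Subgroup.centralizer ({γ₀} : Set (quasiSplit F E c 3).arithmeticSubgroup)) // n ≠ 1},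
          f ((g)⁻¹ * (((n.1 : (quasiSplit F E c 3).arithmeticSubgroup) * γ₀ : (quasiSplit F E c 3).arithmeticSubgroup) : (quasiSplit F E c 3).Adelic) * (g))) -
        Set.indicator {z : (quasiSplit F E c 3).Adelic | T < borelHeight z}
          (fun z => ((μA.map (traceZeroLine F E c hcδ hδ)) (traceZeroFundamentalDomain F E c)).toReal⁻¹ • ∫ w : traceZeroAdele F E c,
            f (z⁻¹ * ((γ₀ : (quasiSplit F E c 3).Adelic) * (((heisElt hc 0 w : unipotentInBorel F E c 3) : borelAdelic F E c 3) : (quasiSplit F E c 3).Adelic)) * z) ∂(μA.map (traceZeroLine F E c hcδ hδ))) (g))) hψm hψinv hfin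
  -- ### Step B — (c5)(10): the `K`-average is absorbed into `f^K`
  have h10 : ∀ b : borelAdelic F E c 3,
      (∫ k : ↥((standardMaximalCompactGL 3 E).comap (adelicVal F E c 3 ((StdForm.antidiagonal 3).over E)) : Subgroup (quasiSplit F E c 3).Adelic), (fun g : (quasiSplit F E c 3).Adelic => ((∑' n : {n : ↥((adelicUnipotent F E c 3).subgroupOf (quasiSplit F E c 3).arithmeticSubgroup ⊓
            Subgroup.centralizer ({γ₀} : Set (quasiSplit F E c 3).arithmeticSubgroup)) // n ≠ 1},
          f ((g)⁻¹ * (((n.1 : (quasiSplit F E c 3).arithmeticSubgroup) * γ₀ : (quasiSplit F E c 3).arithmeticSubgroup) : (quasiSplit F E c 3).Adelic) * (g))) -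
        Set.indicator {z : (quasiSplit F E c 3).Adelic | T < borelHeight z}
          (fun z => ((μA.map (traceZeroLine F E c hcδ hδ)) (traceZeroFundamentalDomain F E c)).toReal⁻¹ • ∫ w : traceZeroAdele F E c,
            f (z⁻¹ * ((γ₀ : (quasiSplit F E c 3).Adelic) * (((heisElt hc 0 w : unipotentInBorel F E c 3) : borelAdelic F E c 3) : (quasiSplit F E c 3).Adelic)) * z) ∂(μA.map (traceZeroLine F E c hcδ hδ))) (g))) ((b : (quasiSplit F E c 3).Adelic) * (k : (quasiSplit F E c 3).Adelic)) ∂μK) = ((∑' n : {n : ↥((adelicUnipotent F E c 3).subgroupOf (quasiSplit F E c 3).arithmeticSubgroup ⊓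
            Subgroup.centralizer ({γ₀} : Set (quasiSplit F E c 3).arithmeticSubgroup)) // n ≠ 1},
          (fun z : (quasiSplit F E c 3).Adelic => (∫ k : ↥((standardMaximalCompactGL 3 E).comap (adelicVal F E c 3 ((StdForm.antidiagonal 3).over E)) : Subgroup (quasiSplit F E c 3).Adelic), f ((k : (quasiSplit F E c 3).Adelic)⁻¹ * (z) * (k : (quasiSplit F E c 3).Adelic)) ∂μK)) (((b : (quasiSplit F E c 3).Adelic))⁻¹ * (((n.1 : (quasiSplit F E c 3).arithmeticSubgroup) * γ₀ : (quasiSplit F E c 3).arithmeticSubgroup) : (quasiSplit F E c 3).Adelic) * ((b : (quasiSplit F E c 3).Adelic)))) -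
        Set.indicator {z : (quasiSplit F E c 3).Adelic | T < borelHeight z}
          (fun z => ((μA.map (traceZeroLine F E c hcδ hδ)) (traceZeroFundamentalDomain F E c)).toReal⁻¹ • ∫ w : traceZeroAdele F E c,
            (fun z : (quasiSplit F E c 3).Adelic => (∫ k : ↥((standardMaximalCompactGL 3 E).comap (adelicVal F E c 3 ((StdForm.antidiagonal 3).over E)) : Subgroup (quasiSplit F E c 3).Adelic), f ((k : (quasiSplit F E c 3).Adelic)⁻¹ * (z) * (k : (quasiSplit F E c 3).Adelic)) ∂μK)) (z⁻¹ * ((γ₀ : (quasiSplit F E c 3).Adelic) * (((heisElt hc 0 w : unipotentInBorel F E c 3) : borelAdelic F E c 3) : (quasiSplit F E c 3).Adelic)) * z) ∂(μA.map (traceZeroLine F E c hcδ hδ))) ((b : (quasiSplit F E c 3).Adelic))) := fun b =>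
    integral_singularBracket_mul_eq_singularBracket_kAverage hc γ₀ hKc μK hH (μA.map (traceZeroLine F E c hcδ hδ)) hf.hasCompactSupport' hf.continuous' T (b : (quasiSplit F E c 3).Adelic)
  -- ### Step C — (G-c): down to `T(𝔸) × N(𝔸)`
  have hΘBm : Measurable fun b : borelAdelic F E c 3 => ((∑' n : {n : ↥((adelicUnipotent F E c 3).subgroupOf (quasiSplit F E c 3).arithmeticSubgroup ⊓
            Subgroup.centralizer ({γ₀} : Set (quasiSplit F E c 3).arithmeticSubgroup)) // n ≠ 1},
          (fun z : (quasiSplit F E c 3).Adelic => (∫ k : ↥((standardMaximalCompactGL 3 E).comap (adelicVal F E c 3 ((StdForm.antidiagonal 3).over E)) : Subgroup (quasiSplit F E c 3).Adelic), f ((k : (quasiSplit F E c 3).Adelic)⁻¹ * (z) * (k : (quasiSplit F E c 3).Adelic)) ∂μK)) (((b : (quasiSplit F E c 3).Adelic))⁻¹ * (((n.1 : (quasiSplit F E c 3).arithmeticSubgroup) * γ₀ : (quasiSplit F E c 3).arithmeticSubgroup) : (quasiSplit F E c 3).Adelic) * ((b : (quasiSplit F E c 3).Adelic)))) -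
        Set.indicator {z : (quasiSplit F E c 3).Adelic | T < borelHeight z}
          (fun z => ((μA.map (traceZeroLine F E c hcδ hδ)) (traceZeroFundamentalDomain F E c)).toReal⁻¹ • ∫ w : traceZeroAdele F E c,
            (fun z : (quasiSplit F E c 3).Adelic => (∫ k : ↥((standardMaximalCompactGL 3 E).comap (adelicVal F E c 3 ((StdForm.antidiagonal 3).over E)) : Subgroup (quasiSplit F E c 3).Adelic), f ((k : (quasiSplit F E c 3).Adelic)⁻¹ * (z) * (k : (quasiSplit F E c 3).Adelic)) ∂μK)) (z⁻¹ * ((γ₀ : (quasiSplit F E c 3).Adelic) * (((heisElt hc 0 w : unipotentInBorel F E c 3) : borelAdelic F E c 3) : (quasiSplit F E c 3).Adelic)) * z) ∂(μA.map (traceZeroLine F E c hcδ hδ))) ((b : (quasiSplit F E c 3).Adelic))) :=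
    (measurable_singularBracket hc γ₀ (μA.map (traceZeroLine F E c hcδ hδ)) T hfKc).comp continuous_subtype_val.measurable
  have hintB' : Integrable (fun b : borelAdelic F E c 3 =>
      ({u : unipotentInBorel F E c 3 | heisY hc u ∈ (traceZeroFundamentalDomain F E c)}.indicator (1 : unipotentInBorel F E c 3 → ℝ≥0∞)
          ⟨b * (torusPart b)⁻¹, mul_torusPart_inv_mem_unipotentInBorel b⟩ *
        wT ⟨torusPart b, torusPart_mem_torusAdelic b⟩).toReal • ((∑' n : {n : ↥((adelicUnipotent F E c 3).subgroupOf (quasiSplit F E c 3).arithmeticSubgroup ⊓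
            Subgroup.centralizer ({γ₀} : Set (quasiSplit F E c 3).arithmeticSubgroup)) // n ≠ 1},
          (fun z : (quasiSplit F E c 3).Adelic => (∫ k : ↥((standardMaximalCompactGL 3 E).comap (adelicVal F E c 3 ((StdForm.antidiagonal 3).over E)) : Subgroup (quasiSplit F E c 3).Adelic), f ((k : (quasiSplit F E c 3).Adelic)⁻¹ * (z) * (k : (quasiSplit F E c 3).Adelic)) ∂μK)) (((b : (quasiSplit F E c 3).Adelic))⁻¹ * (((n.1 : (quasiSplit F E c 3).arithmeticSubgroup) * γ₀ : (quasiSplit F E c 3).arithmeticSubgroup) : (quasiSplit F E c 3).Adelic) * ((b : (quasiSplit F E c 3).Adelic)))) -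
        Set.indicator {z : (quasiSplit F E c 3).Adelic | T < borelHeight z}
          (fun z => ((μA.map (traceZeroLine F E c hcδ hδ)) (traceZeroFundamentalDomain F E c)).toReal⁻¹ • ∫ w : traceZeroAdele F E c,
            (fun z : (quasiSplit F E c 3).Adelic => (∫ k : ↥((standardMaximalCompactGL 3 E).comap (adelicVal F E c 3 ((StdForm.antidiagonal 3).over E)) : Subgroup (quasiSplit F E c 3).Adelic), f ((k : (quasiSplit F E c 3).Adelic)⁻¹ * (z) * (k : (quasiSplit F E c 3).Adelic)) ∂μK)) (z⁻¹ * ((γ₀ : (quasiSplit F E c 3).Adelic) * (((heisElt hc 0 w : unipotentInBorel F E c 3) : borelAdelic F E c 3) : (quasiSplit F E c 3).Adelic)) * z) ∂(μA.map (traceZeroLine F E c hcδ hδ))) ((b : (quasiSplit F E c 3).Adelic)))) μB := by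
    refine hintB.congr (ae_of_all _ fun b => ?_)
    simp only [h10]
  obtain ⟨-, hGc⟩ := integral_indicatorProductWeight_smul_eq_of_coord hc hc1 μB μT (heisHaar hc μX (μA.map (traceZeroLine F E c hcδ hδ))) hC₂0 hC₂t hform
    (measurableSet_centreBox hc) hwT.measurable hΘBm hintB'
  -- ### Step D — per torus point: FILE C at `k = 1`, then (c5)(8)
  have hper : ∀ t : torusInBorel F E c 3,
      (∫ n in {u : unipotentInBorel F E c 3 | heisY hc u ∈ (traceZeroFundamentalDomain F E c)},
        (fun b : borelAdelic F E c 3 => ((∑' n : {n : ↥((adelicUnipotent F E c 3).subgroupOf (quasiSplit F E c 3).arithmeticSubgroup ⊓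
            Subgroup.centralizer ({γ₀} : Set (quasiSplit F E c 3).arithmeticSubgroup)) // n ≠ 1},
          (fun z : (quasiSplit F E c 3).Adelic => (∫ k : ↥((standardMaximalCompactGL 3 E).comap (adelicVal F E c 3 ((StdForm.antidiagonal 3).over E)) : Subgroup (quasiSplit F E c 3).Adelic), f ((k : (quasiSplit F E c 3).Adelic)⁻¹ * (z) * (k : (quasiSplit F E c 3).Adelic)) ∂μK)) (((b : (quasiSplit F E c 3).Adelic))⁻¹ * (((n.1 : (quasiSplit F E c 3).arithmeticSubgroup) * γ₀ : (quasiSplit F E c 3).arithmeticSubgroup) : (quasiSplit F E c 3).Adelic) * ((b : (quasiSplit F E c 3).Adelic)))) -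
        Set.indicator {z : (quasiSplit F E c 3).Adelic | T < borelHeight z}
          (fun z => ((μA.map (traceZeroLine F E c hcδ hδ)) (traceZeroFundamentalDomain F E c)).toReal⁻¹ • ∫ w : traceZeroAdele F E c,
            (fun z : (quasiSplit F E c 3).Adelic => (∫ k : ↥((standardMaximalCompactGL 3 E).comap (adelicVal F E c 3 ((StdForm.antidiagonal 3).over E)) : Subgroup (quasiSplit F E c 3).Adelic), f ((k : (quasiSplit F E c 3).Adelic)⁻¹ * (z) * (k : (quasiSplit F E c 3).Adelic)) ∂μK)) (z⁻¹ * ((γ₀ : (quasiSplit F E c 3).Adelic) * (((heisElt hc 0 w : unipotentInBorel F E c 3) : borelAdelic F E c 3) : (quasiSplit F E c 3).Adelic)) * z) ∂(μA.map (traceZeroLine F E c hcδ hδ))) ((b : (quasiSplit F E c 3).Adelic)))) ((n : borelAdelic F E c 3) * (t : borelAdelic F E c 3)) ∂(heisHaar hc μX (μA.map (traceZeroLine F E c hcδ hδ)))) =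
      Θ T t := fun t => by
    have hδpos : (0 : ℝ) < ((torusRootModulus E 3 (diagUnit (t : borelAdelic F E c 3).2) : ℝ≥0) : ℝ) := by
      exact_mod_cast torusRootModulus_pos E 3 _
    -- FILE C at `k = 1`
    have hC := torusRootModulus_inv_smul_setIntegral_box_singularBracket_mul_torus_eq hc hc1 hab hg₀ hγ₀ μX (μA.map (traceZeroLine F E c hcδ hδ)) t (1 : (quasiSplit F E c 3).Adelic) T
      hfKs hfKc (measurableSet_traceZeroFundamentalDomain (F := F) (E := E) (c := c))
    simp only [mul_one, inv_one, one_mul] at hC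
    rw [← centreBox_eq_image_heisHomeomorph] at hC
    -- (c5)(8)
    have h8 := singularFibre_eq_tateIntegrand (E := E) (c := c) hc hcδ hδ μA t
      (fun w : traceZeroAdele F E c => ∫ x : AdeleRing (𝓞 E) E, (∫ k : ↥((standardMaximalCompactGL 3 E).comap (adelicVal F E c 3 ((StdForm.antidiagonal 3).over E)) : Subgroup (quasiSplit F E c 3).Adelic), f ((k : (quasiSplit F E c 3).Adelic)⁻¹ * ((((heisElt hc x (0 : traceZeroAdele F E c) : unipotentInBorel F E c 3) : borelAdelic F E c 3) : (quasiSplit F E c 3).Adelic)⁻¹ * ((γ₀ : (quasiSplit F E c 3).Adelic) * (((heisElt hc 0 w : unipotentInBorel F E c 3) : borelAdelic F E c 3) : (quasiSplit F E c 3).Adelic)) * (((heisElt hc x (0 : traceZeroAdele F E c) : unipotentInBorel F E c 3) : borelAdelic F E c 3) : (quasiSplit F E c 3).Adelic)) * (k : (quasiSplit F E c 3).Adelic)) ∂μK) ∂μX) hT' (borelHeight (1 : (quasiSplit F E c 3).Adelic))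
    rw [h8] at hC
    -- undo the `δ_B⁻¹`
    have hC' := congrArg (fun z : ℂ => (((torusRootModulus E 3 (diagUnit (t : borelAdelic F E c 3).2) : ℝ≥0) : ℝ)) • z) hC
    simp only [smul_inv_smul₀ hδpos.ne'] at hC'
    rw [hΘ]
    simp only [hR]
    rw [← hC']
    rfl
  -- ### Step E — assemble
  rw [hA]
  have hB : (∫ b : borelAdelic F E c 3,
      ({u : unipotentInBorel F E c 3 | heisY hc u ∈ (traceZeroFundamentalDomain F E c)}.indicator (1 : unipotentInBorel F E c 3 → ℝ≥0∞)
          ⟨b * (torusPart b)⁻¹, mul_torusPart_inv_mem_unipotentInBorel b⟩ *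
        wT ⟨torusPart b, torusPart_mem_torusAdelic b⟩).toReal •
        (∫ k : ↥((standardMaximalCompactGL 3 E).comap (adelicVal F E c 3 ((StdForm.antidiagonal 3).over E)) : Subgroup (quasiSplit F E c 3).Adelic), (fun g : (quasiSplit F E c 3).Adelic => ((∑' n : {n : ↥((adelicUnipotent F E c 3).subgroupOf (quasiSplit F E c 3).arithmeticSubgroup ⊓
            Subgroup.centralizer ({γ₀} : Set (quasiSplit F E c 3).arithmeticSubgroup)) // n ≠ 1},
          f ((g)⁻¹ * (((n.1 : (quasiSplit F E c 3).arithmeticSubgroup) * γ₀ : (quasiSplit F E c 3).arithmeticSubgroup) : (quasiSplit F E c 3).Adelic) * (g))) -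
        Set.indicator {z : (quasiSplit F E c 3).Adelic | T < borelHeight z}
          (fun z => ((μA.map (traceZeroLine F E c hcδ hδ)) (traceZeroFundamentalDomain F E c)).toReal⁻¹ • ∫ w : traceZeroAdele F E c,
            f (z⁻¹ * ((γ₀ : (quasiSplit F E c 3).Adelic) * (((heisElt hc 0 w : unipotentInBorel F E c 3) : borelAdelic F E c 3) : (quasiSplit F E c 3).Adelic)) * z) ∂(μA.map (traceZeroLine F E c hcδ hδ))) (g))) ((b : (quasiSplit F E c 3).Adelic) * (k : (quasiSplit F E c 3).Adelic)) ∂μK) ∂μB) =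
      ∫ b : borelAdelic F E c 3,
      ({u : unipotentInBorel F E c 3 | heisY hc u ∈ (traceZeroFundamentalDomain F E c)}.indicator (1 : unipotentInBorel F E c 3 → ℝ≥0∞)
          ⟨b * (torusPart b)⁻¹, mul_torusPart_inv_mem_unipotentInBorel b⟩ *
        wT ⟨torusPart b, torusPart_mem_torusAdelic b⟩).toReal • ((∑' n : {n : ↥((adelicUnipotent F E c 3).subgroupOf (quasiSplit F E c 3).arithmeticSubgroup ⊓
            Subgroup.centralizer ({γ₀} : Set (quasiSplit F E c 3).arithmeticSubgroup)) // n ≠ 1},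
          (fun z : (quasiSplit F E c 3).Adelic => (∫ k : ↥((standardMaximalCompactGL 3 E).comap (adelicVal F E c 3 ((StdForm.antidiagonal 3).over E)) : Subgroup (quasiSplit F E c 3).Adelic), f ((k : (quasiSplit F E c 3).Adelic)⁻¹ * (z) * (k : (quasiSplit F E c 3).Adelic)) ∂μK)) (((b : (quasiSplit F E c 3).Adelic))⁻¹ * (((n.1 : (quasiSplit F E c 3).arithmeticSubgroup) * γ₀ : (quasiSplit F E c 3).arithmeticSubgroup) : (quasiSplit F E c 3).Adelic) * ((b : (quasiSplit F E c 3).Adelic)))) -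
        Set.indicator {z : (quasiSplit F E c 3).Adelic | T < borelHeight z}
          (fun z => ((μA.map (traceZeroLine F E c hcδ hδ)) (traceZeroFundamentalDomain F E c)).toReal⁻¹ • ∫ w : traceZeroAdele F E c,
            (fun z : (quasiSplit F E c 3).Adelic => (∫ k : ↥((standardMaximalCompactGL 3 E).comap (adelicVal F E c 3 ((StdForm.antidiagonal 3).over E)) : Subgroup (quasiSplit F E c 3).Adelic), f ((k : (quasiSplit F E c 3).Adelic)⁻¹ * (z) * (k : (quasiSplit F E c 3).Adelic)) ∂μK)) (z⁻¹ * ((γ₀ : (quasiSplit F E c 3).Adelic) * (((heisElt hc 0 w : unipotentInBorel F E c 3) : borelAdelic F E c 3) : (quasiSplit F E c 3).Adelic)) * z) ∂(μA.map (traceZeroLine F E c hcδ hδ))) ((b : (quasiSplit F E c 3).Adelic))) ∂μB :=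
    integral_congr_ae (ae_of_all _ fun b => by simp only [h10])
  rw [hB, hGc]
  have hD : (∫ t : torusInBorel F E c 3,
      ((wT t).toReal * ((torusRootModulus E 3 (diagUnit (t : borelAdelic F E c 3).2) : ℝ≥0) : ℝ)⁻¹) •
        ∫ n in {u : unipotentInBorel F E c 3 | heisY hc u ∈ (traceZeroFundamentalDomain F E c)},
          (fun b : borelAdelic F E c 3 => ((∑' n : {n : ↥((adelicUnipotent F E c 3).subgroupOf (quasiSplit F E c 3).arithmeticSubgroup ⊓
            Subgroup.centralizer ({γ₀} : Set (quasiSplit F E c 3).arithmeticSubgroup)) // n ≠ 1},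
          (fun z : (quasiSplit F E c 3).Adelic => (∫ k : ↥((standardMaximalCompactGL 3 E).comap (adelicVal F E c 3 ((StdForm.antidiagonal 3).over E)) : Subgroup (quasiSplit F E c 3).Adelic), f ((k : (quasiSplit F E c 3).Adelic)⁻¹ * (z) * (k : (quasiSplit F E c 3).Adelic)) ∂μK)) (((b : (quasiSplit F E c 3).Adelic))⁻¹ * (((n.1 : (quasiSplit F E c 3).arithmeticSubgroup) * γ₀ : (quasiSplit F E c 3).arithmeticSubgroup) : (quasiSplit F E c 3).Adelic) * ((b : (quasiSplit F E c 3).Adelic)))) -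
        Set.indicator {z : (quasiSplit F E c 3).Adelic | T < borelHeight z}
          (fun z => ((μA.map (traceZeroLine F E c hcδ hδ)) (traceZeroFundamentalDomain F E c)).toReal⁻¹ • ∫ w : traceZeroAdele F E c,
            (fun z : (quasiSplit F E c 3).Adelic => (∫ k : ↥((standardMaximalCompactGL 3 E).comap (adelicVal F E c 3 ((StdForm.antidiagonal 3).over E)) : Subgroup (quasiSplit F E c 3).Adelic), f ((k : (quasiSplit F E c 3).Adelic)⁻¹ * (z) * (k : (quasiSplit F E c 3).Adelic)) ∂μK)) (z⁻¹ * ((γ₀ : (quasiSplit F E c 3).Adelic) * (((heisElt hc 0 w : unipotentInBorel F E c 3) : borelAdelic F E c 3) : (quasiSplit F E c 3).Adelic)) * z) ∂(μA.map (traceZeroLine F E c hcδ hδ))) ((b : (quasiSplit F E c 3).Adelic)))) ((n : borelAdelic F E c 3) * (t : borelAdelic F E c 3)) ∂(heisHaar hc μX (μA.map (traceZeroLine F E c hcδ hδ))) ∂μT) =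
      ∫ t : torusInBorel F E c 3,
      ((wT t).toReal * ((torusRootModulus E 3 (diagUnit (t : borelAdelic F E c 3).2) : ℝ≥0) : ℝ)⁻¹) • Θ T t ∂μT :=
    integral_congr_ae (ae_of_all _ fun t => by beta_reduce; rw [hper t])
  rw [hD, hlin T hT]
  push_cast
  ring

end UnitaryGroup

end Literature.NumberTheory.Automorphic
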